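import Mathlib.Analysis.InnerProductSpace.Continuous
import Mathlib.Analysis.Normed.Module.RCLike.Basic
import Mathlib.Topology.Separation.Basic
import HarnessLib

/-!
# Orthonormal pairs in a form core: Gram–Schmidt continuity in the graph topology

Topic `Literature/Analysis/InnerProduct`; companion of `KyFanOrthonormal.lean` (Ky Fan's lower bound
for two levels) serving the *upper-bound* half of two-level variational statements. The tree states
"the sum of the two lowest eigenvalues" of a many-body Hamiltonian as a Ky-Fan infimum of the energy
form over orthonormal pairs taken in a convenient CORE of smooth functions
(`Literature.MathematicalPhysics.QuantumManyBody.BoseGas.kyFanTwo`, `…BoccatoEtAl2019_firstGap_GP`: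
`C¹` periodic Bose-symmetric trial states), whereas the pairs produced by a proof (eigenvectors,
or images of Fock-space vectors under Bogoliubov transformations as in
[Boccato–Brennecke–Cenatiempo–Schlein 2019, §6]) only lie in the form domain. This file proves the
abstract approximation step closing that gap: for a non-negative closed form written as
`q(x) = ‖A x‖²` with a linear map `A : E →ₗ F` (every closed non-negative form is of this type,
`A = H^{1/2}`; for `-Δ + V`, `A x = (∇x, V^{1/2}x)`), and a subspace `D ⊆ E` that is dense for the
graph norm `‖x‖ + ‖A x‖` (a form core), every orthonormal pair `y₁, y₂` of `E` and every `ε > 0`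
admit an orthonormal pair `x₁, x₂ ∈ D` with

  `‖A x₁‖² + ‖A x₂‖² < ‖A y₁‖² + ‖A y₂‖² + ε`          (`exists_orthonormal_pair_mem_of_graphDense`),

so the Ky-Fan infimum over `D` equals the one over `E` (Reed–Simon IV, Thm. XIII.2: in the min–max
principle "`Q(H)` may be replaced by any form core"; Reed–Simon I, Thm. VIII.15 ff. for forms and
cores). The proof is Gram–Schmidt: approximate `yⱼ` by `xⱼ ∈ D` in graph norm, normalise `x₁`,
project it out of `x₂`, normalise; the resulting pair depends continuously, in the graph topology
(realised on `(E × F)²` through the points `(x, A x)`), on `(x₁, x₂)` near the orthonormal pair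
`(y₁, y₂)`, where it is the identity. Also the one-vector version
(`exists_unit_mem_of_graphDense`: the bottom of the form over `D` equals the bottom over `E`).

`F` is only a normed space; `𝕜 = ℝ` or `ℂ`. No definitions, no named facts.

## References

* M. Reed, B. Simon, *Methods of Modern Mathematical Physics IV: Analysis of Operators* (1978),
  Thm. XIII.1–XIII.2 (min–max principle over a form core). [folklore form used here]
* M. Reed, B. Simon, *Methods of Modern Mathematical Physics I*, §VIII.6 (quadratic forms, cores).
* C. Boccato, C. Brennecke, S. Cenatiempo, B. Schlein, Acta Math. 222 (2019), §6 [BoccatoEtAl2019Acta]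
  — the min–max argument this step serves in the tree.
-/

noncomputable section

open scoped InnerProductSpace
open Filter Topology

namespace Literature.Analysis.InnerProduct

variable {𝕜 : Type*} [RCLike 𝕜] {E : Type*} [NormedAddCommGroup E] [InnerProductSpace 𝕜 E]
  {F : Type*} [NormedAddCommGroup F] [NormedSpace 𝕜 F]

/-- Normalising a non-zero vector by the real scalar `‖x‖⁻¹` (cast to `𝕜`) gives a unit vector.
[folklore] -/
theorem norm_ofReal_inv_norm_smul {x : E} (hx : x ≠ 0) :
    ‖((‖x‖⁻¹ : ℝ) : 𝕜) • x‖ = 1 := by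
  rw [norm_smul, RCLike.norm_ofReal, abs_of_nonneg (inv_nonneg.2 (norm_nonneg x)),
    inv_mul_cancel₀ (norm_ne_zero_iff.2 hx)]

/-- **Gram–Schmidt for a pair.** If `u₁` is a unit vector and `w = x₂ - ⟪u₁, x₂⟫ u₁ ≠ 0`, then
`u₂ = ‖w‖⁻¹ w` is a unit vector orthogonal to `u₁`. [folklore] -/
theorem gramSchmidt_pair {u₁ x₂ : E} (hu₁ : ‖u₁‖ = 1)
    (hw : x₂ - (⟪u₁, x₂⟫_𝕜) • u₁ ≠ 0) :
    ‖((‖x₂ - (⟪u₁, x₂⟫_𝕜) • u₁‖⁻¹ : ℝ) : 𝕜) • (x₂ - (⟪u₁, x₂⟫_𝕜) • u₁)‖ = 1 ∧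
      ⟪u₁, ((‖x₂ - (⟪u₁, x₂⟫_𝕜) • u₁‖⁻¹ : ℝ) : 𝕜) • (x₂ - (⟪u₁, x₂⟫_𝕜) • u₁)⟫_𝕜 = 0 := by
  refine ⟨norm_ofReal_inv_norm_smul hw, ?_⟩
  have h0 : ⟪u₁, x₂ - (⟪u₁, x₂⟫_𝕜) • u₁⟫_𝕜 = 0 := by
    rw [inner_sub_right, inner_smul_right, inner_self_eq_norm_sq_to_K, hu₁]
    simp
  rw [inner_smul_right, h0, mul_zero]

/-- **Orthonormal pairs can be taken in a form core (Ky Fan's infimum over a core).** Let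
`A : E →ₗ F` be a linear map from an inner product space to a normed space (the form
`q(x) = ‖A x‖²`) and `D ⊆ E` a subspace dense for the graph norm: every `y` is approximated by
`x ∈ D` with `‖x - y‖` and `‖A x - A y‖` small. Then for every orthonormal pair `y₁, y₂ ∈ E` and
`ε > 0` there is an orthonormal pair `x₁, x₂ ∈ D` with
`‖A x₁‖² + ‖A x₂‖² < ‖A y₁‖² + ‖A y₂‖² + ε`. Consequently
`inf {q(x₁) + q(x₂) : x₁ ⊥ x₂ unit, xⱼ ∈ D} = inf {… : xⱼ ∈ E}` — the Ky-Fan / min–max values of a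
closed form may be computed on any form core (Reed–Simon IV, Thm. XIII.2). Proof: Gram–Schmidt
applied to graph-norm approximants, by continuity of the Gram–Schmidt pair in the graph topology at
the orthonormal pair `(y₁, y₂)`. [folklore] -/
theorem exists_orthonormal_pair_mem_of_graphDense (A : E →ₗ[𝕜] F) (D : Submodule 𝕜 E)
    (hD : ∀ y : E, ∀ δ : ℝ, 0 < δ → ∃ x ∈ D, ‖x - y‖ < δ ∧ ‖A x - A y‖ < δ)
    {y₁ y₂ : E} (h₁ : ‖y₁‖ = 1) (h₂ : ‖y₂‖ = 1) (h₁₂ : ⟪y₁, y₂⟫_𝕜 = 0) {ε : ℝ} (hε : 0 < ε) :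
    ∃ x₁ ∈ D, ∃ x₂ ∈ D, ‖x₁‖ = 1 ∧ ‖x₂‖ = 1 ∧ ⟪x₁, x₂⟫_𝕜 = 0 ∧
      ‖A x₁‖ ^ 2 + ‖A x₂‖ ^ 2 < ‖A y₁‖ ^ 2 + ‖A y₂‖ ^ 2 + ε := by
  -- Gram–Schmidt in graph coordinates `p = ((x₁, a₁), (x₂, a₂))`, `aⱼ` standing for `A xⱼ`.
  let c₁ : (E × F) × (E × F) → 𝕜 := fun p => ((‖p.1.1‖⁻¹ : ℝ) : 𝕜)
  let U₁ : (E × F) × (E × F) → E × F := fun p => c₁ p • p.1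
  let T : (E × F) × (E × F) → 𝕜 := fun p => ⟪(U₁ p).1, p.2.1⟫_𝕜
  let W : (E × F) × (E × F) → E × F := fun p => p.2 - T p • U₁ p
  let c₂ : (E × F) × (E × F) → 𝕜 := fun p => ((‖(W p).1‖⁻¹ : ℝ) : 𝕜)
  let U₂ : (E × F) × (E × F) → E × F := fun p => c₂ p • W p
  let Φ : (E × F) × (E × F) → ℝ := fun p => ‖(U₁ p).2‖ ^ 2 + ‖(U₂ p).2‖ ^ 2
  let P₀ : (E × F) × (E × F) := ((y₁, A y₁), (y₂, A y₂))
  -- values at the orthonormal pair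
  have hy₁ : y₁ ≠ 0 := fun h => by simp [h] at h₁
  have hy₂ : y₂ ≠ 0 := fun h => by simp [h] at h₂
  have hc₁P : c₁ P₀ = 1 := by simp [c₁, P₀, h₁]
  have hU₁P : U₁ P₀ = (y₁, A y₁) := by simp [U₁, hc₁P, P₀]
  have hTP : T P₀ = 0 := by simp [T, hU₁P, P₀, h₁₂]
  have hWP : W P₀ = (y₂, A y₂) := by simp [W, hTP, P₀]
  have hc₂P : c₂ P₀ = 1 := by simp [c₂, hWP, h₂]
  have hU₂P : U₂ P₀ = (y₂, A y₂) := by simp [U₂, hc₂P, hWP]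
  have hΦP : Φ P₀ = ‖A y₁‖ ^ 2 + ‖A y₂‖ ^ 2 := by simp [Φ, hU₁P, hU₂P]
  -- continuity at `P₀` (the only singular operations are the two inversions, at norms equal to 1)
  have hn₁ : ContinuousAt (fun p : (E × F) × (E × F) => ‖p.1.1‖) P₀ :=
    (continuous_fst.comp continuous_fst).norm.continuousAt
  have hc₁ : ContinuousAt c₁ P₀ :=
    RCLike.continuous_ofReal.continuousAt.comp (hn₁.inv₀ (by simp [P₀, h₁]))
  have hU₁ : ContinuousAt U₁ P₀ := hc₁.smul continuousAt_fst
  have hT : ContinuousAt T P₀ :=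
    (continuous_fst.continuousAt.comp hU₁).inner (continuous_fst.comp continuous_snd).continuousAt
  have hW : ContinuousAt W P₀ := continuousAt_snd.sub (hT.smul hU₁)
  have hn₂ : ContinuousAt (fun p : (E × F) × (E × F) => ‖(W p).1‖) P₀ :=
    (continuous_fst.norm.continuousAt).comp hW
  have hn₂P : ‖(W P₀).1‖ = 1 := by simp [hWP, h₂]
  have hc₂ : ContinuousAt c₂ P₀ :=
    RCLike.continuous_ofReal.continuousAt.comp (hn₂.inv₀ (by rw [hn₂P]; exact one_ne_zero))
  have hU₂ : ContinuousAt U₂ P₀ := hc₂.smul hW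
  have hΦ : ContinuousAt Φ P₀ :=
    ((continuous_snd.norm.continuousAt.comp hU₁).pow 2).add
      ((continuous_snd.norm.continuousAt.comp hU₂).pow 2)
  -- a graph-norm neighbourhood of `P₀` on which `Φ < Φ P₀ + ε` and Gram–Schmidt is non-degenerate
  have hev : ∀ᶠ p in 𝓝 P₀, Φ p < Φ P₀ + ε ∧ ‖p.1.1‖ ≠ 0 ∧ ‖(W p).1‖ ≠ 0 := by
    refine (hΦ.eventually_lt continuousAt_const (lt_add_of_pos_right _ hε)).and
      ((hn₁.eventually_ne ?_).and (hn₂.eventually_ne ?_))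
    · simp [P₀, h₁]
    · rw [hn₂P]; exact one_ne_zero
  obtain ⟨δ, hδ, hball⟩ := Metric.eventually_nhds_iff.1 hev
  -- graph-norm approximants in the core
  obtain ⟨x₁, hx₁D, hx₁, hAx₁⟩ := hD y₁ δ hδ
  obtain ⟨x₂, hx₂D, hx₂, hAx₂⟩ := hD y₂ δ hδ
  let p : (E × F) × (E × F) := ((x₁, A x₁), (x₂, A x₂))
  have hdist : dist p P₀ < δ := by
    change dist ((x₁, A x₁), (x₂, A x₂)) ((y₁, A y₁), (y₂, A y₂)) < δ
    rw [Prod.dist_eq, Prod.dist_eq, Prod.dist_eq, dist_eq_norm, dist_eq_norm, dist_eq_norm,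
      dist_eq_norm]
    exact max_lt (max_lt hx₁ hAx₁) (max_lt hx₂ hAx₂)
  obtain ⟨hΦp, hp₁, hp₂⟩ := hball hdist
  -- the Gram–Schmidt pair at `p` lies in `D` and `A` passes through it
  have hx₁0 : x₁ ≠ 0 := fun h => hp₁ (by
    change ‖x₁‖ = 0
    rw [h, norm_zero])
  have hU₁p1 : (U₁ p).1 = c₁ p • x₁ := rfl
  have hU₁p2 : (U₁ p).2 = A (U₁ p).1 := by
    change c₁ p • A x₁ = A (c₁ p • x₁)
    rw [map_smul]
  have hWp1 : (W p).1 = x₂ - T p • (U₁ p).1 := rfl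
  have hWp2 : (W p).2 = A (W p).1 := by
    change A x₂ - T p • (U₁ p).2 = A (x₂ - T p • (U₁ p).1)
    rw [map_sub, map_smul, ← hU₁p2]
  have hU₂p2 : (U₂ p).2 = A (U₂ p).1 := by
    change c₂ p • (W p).2 = A (c₂ p • (W p).1)
    rw [map_smul, hWp2]
  have hu₁norm : ‖(U₁ p).1‖ = 1 := by
    rw [hU₁p1]
    exact norm_ofReal_inv_norm_smul hx₁0
  have hW0 : (W p).1 ≠ 0 := fun h => hp₂ (by rw [h, norm_zero])
  have hgs := gramSchmidt_pair (𝕜 := 𝕜) (u₁ := (U₁ p).1) (x₂ := x₂) hu₁norm (by rwa [hWp1] at hW0)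
  have hU₂p1 : (U₂ p).1 =
      ((‖x₂ - (⟪(U₁ p).1, x₂⟫_𝕜) • (U₁ p).1‖⁻¹ : ℝ) : 𝕜) • (x₂ - (⟪(U₁ p).1, x₂⟫_𝕜) • (U₁ p).1) :=
    rfl
  refine ⟨(U₁ p).1, ?_, (U₂ p).1, ?_, hu₁norm, ?_, ?_, ?_⟩
  · rw [hU₁p1]; exact D.smul_mem _ hx₁D
  · rw [hU₂p1]
    exact D.smul_mem _ (D.sub_mem hx₂D (D.smul_mem _ (D.smul_mem _ hx₁D)))
  · rw [hU₂p1]; exact hgs.1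
  · rw [hU₂p1]; exact hgs.2
  · rw [← hU₁p2, ← hU₂p2, ← hΦP]
    exact hΦp

/-- **Unit vectors can be taken in a form core**: under the same graph-density hypothesis, for every
unit vector `y ∈ E` and `ε > 0` there is a unit vector `x ∈ D` with `‖A x‖² < ‖A y‖² + ε`; hence the
bottom of the form (ground-state energy) over `D` equals the bottom over `E`. [folklore] -/
theorem exists_unit_mem_of_graphDense (A : E →ₗ[𝕜] F) (D : Submodule 𝕜 E)
    (hD : ∀ y : E, ∀ δ : ℝ, 0 < δ → ∃ x ∈ D, ‖x - y‖ < δ ∧ ‖A x - A y‖ < δ)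
    {y : E} (hy : ‖y‖ = 1) {ε : ℝ} (hε : 0 < ε) :
    ∃ x ∈ D, ‖x‖ = 1 ∧ ‖A x‖ ^ 2 < ‖A y‖ ^ 2 + ε := by
  let c : E × F → 𝕜 := fun p => ((‖p.1‖⁻¹ : ℝ) : 𝕜)
  let U : E × F → E × F := fun p => c p • p
  let Φ : E × F → ℝ := fun p => ‖(U p).2‖ ^ 2
  let P₀ : E × F := (y, A y)
  have hcP : c P₀ = 1 := by simp [c, P₀, hy]
  have hUP : U P₀ = (y, A y) := by simp [U, hcP, P₀]
  have hΦP : Φ P₀ = ‖A y‖ ^ 2 := by simp [Φ, hUP]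
  have hn : ContinuousAt (fun p : E × F => ‖p.1‖) P₀ := continuous_fst.norm.continuousAt
  have hc : ContinuousAt c P₀ :=
    RCLike.continuous_ofReal.continuousAt.comp (hn.inv₀ (by simp [P₀, hy]))
  have hU : ContinuousAt U P₀ := hc.smul continuousAt_id
  have hΦ : ContinuousAt Φ P₀ := (continuous_snd.norm.continuousAt.comp hU).pow 2
  have hev : ∀ᶠ p in 𝓝 P₀, Φ p < Φ P₀ + ε ∧ ‖p.1‖ ≠ 0 :=
    (hΦ.eventually_lt continuousAt_const (lt_add_of_pos_right _ hε)).and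
      (hn.eventually_ne (by simp [P₀, hy]))
  obtain ⟨δ, hδ, hball⟩ := Metric.eventually_nhds_iff.1 hev
  obtain ⟨x, hxD, hx, hAx⟩ := hD y δ hδ
  let p : E × F := (x, A x)
  have hdist : dist p P₀ < δ := by
    change dist (x, A x) (y, A y) < δ
    rw [Prod.dist_eq, dist_eq_norm, dist_eq_norm]
    exact max_lt hx hAx
  obtain ⟨hΦp, hp⟩ := hball hdist
  have hx0 : x ≠ 0 := fun h => hp (by
    change ‖x‖ = 0
    rw [h, norm_zero])
  refine ⟨(U p).1, D.smul_mem _ hxD, norm_ofReal_inv_norm_smul hx0, ?_⟩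
  have hUp2 : (U p).2 = A (U p).1 := by
    change c p • A x = A (c p • x)
    rw [map_smul]
  rw [← hUp2, ← hΦP]
  exact hΦp

end Literature.Analysis.InnerProduct

end
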